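import Mathlib
import Summits.Ventures.HodgeRepro.Tier4.Common.AdelicDefs
import Summits.Ventures.HodgeRepro.Tier4.Common.SettingOfData
import Summits.Ventures.HodgeRepro.Tier4.Common.RowPlane
import Summits.Ventures.HodgeRepro.Tier4.Common.RowTorus
import Summits.Ventures.HodgeRepro.Tier4.Line1.AdelicParts
import Summits.Ventures.HodgeRepro.Tier4.Line1.RTFSetting
import Summits.Ventures.HodgeRepro.Tier4.Line4.LevelCosetCongruence
import Summits.Ventures.HodgeRepro.Tier4.Line4.FinitePlacePositivity
import Summits.Ventures.HodgeRepro.Tier4.Line4.L1Class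
import Summits.Ventures.HodgeRepro.Tier4.Line4.LevelTailInstance
import Summits.Ventures.HodgeRepro.Tier4.Line4.LevelTailConv
import Summits.Ventures.HodgeRepro.Tier4.Line4.SparsityScale
import Summits.Ventures.HodgeRepro.Tier4.Line4.OrbitInvariant
import Summits.Ventures.HodgeRepro.Tier4.Line4.OrbitInvariantFinite
import Summits.Ventures.HodgeRepro.Tier4.Line4.IntegralTransport
import Summits.Ventures.HodgeRepro.Tier4.Line4.OrbitInvariantDenominator
import Summits.Ventures.HodgeRepro.Tier4.Line4.RationalDenominator

/-!
# Tier4/Line4/HRWrapper — the `hR` DISCHARGE of the (7b) glue: the sparsity scale `gth` and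
`gth N ≤ archDist γ` off the orbit of `γ₀` on the level support (C-L4-HR-WRAPPER, x2 S15440/S15483)

Blind re-derivation cell `pub-hodge-repro`, Tier 4 «prove the step» (README §9–§10), seat t4-L1-p3 (gen 4).
Tree path `lean/Summits/Ventures/HodgeRepro/Tier4/Line4/HRWrapper.lean`.

The (7b) glue `exists_levelFamily_fibreDominated_of_displays` (x2, TailGlue p707793) binds `(gth : ℕ → ℝ)
(hg : Tendsto gth atTop atTop) (hR : ∀ N γ, orbitOf γ ∉ {orbitOf γ₀} → (∃ t ∈ R.DT, ∃ t' ∈ R.DT', conv … (t⁻¹ γ t') ≠ 0)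
→ gth N ≤ archDist γ)` — the (S-SPARSE) display.  `exists_sparsityScale_hR` PRODUCES the triple on the transported
row plane from the chain of record: `mem_levelSuppSet_conv` (L2-p1: a non-zero value of the convolution puts
`(t, t′)` into the level support, i.e. `ofFinPart (t⁻¹ γ t′) ∈ K(N) γ₀,f K(N)`), the denominator read-out
`log_max_one_le_two_mul_archDist_add_of_orbitInv_ne_smul_seesaw'` (OrbitInvariantDenominator v2) — here in the form
`_seesaw''` with the transport `g` SCALED to a finite-integral `c • g` (`exists_integer_smul_isIntegralFinMat`,
`orbitInv W (c • g) = c² · orbitInv W g`: no integrality of `g` is assumed), the denominators `D` of `γ₀`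
(RationalDenominator) and the bounds `G`, `B` (OrbitInvariantFinite), and L3-p2's sparsity scale
`tendsto_sparsityScale_pow_div` along `lev N = p ^ (N + n₁)` (`2 ≤ p`).  The fibre bridge enters as the NAMED
hypothesis `hbridge : ∀ γ, orbitOf γ ≠ orbitOf γ₀ → orbitInv γ ≠ orbitInv γ₀` (its instance of record is
`orbitInv_ne_of_orbitOf_ne_of_isLinRegular`, LinRegularBridge), so the trace-normalisation re-target of the bridge
never touches this module.  No printed input.  HC_CM is NOT proved by anyone in this repository.
-/

namespace Summit.Ventures.HodgeRepro.Tier4.Line4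

open Summit.Ventures.HodgeRepro.Tier4.Common Summit.Ventures.HodgeRepro.Tier4.Line1
  Summit.Ventures.HodgeRepro.Tier4.Line1.RTF NumberField Matrix MeasureTheory Filter
open scoped NumberField Topology

noncomputable section

/-! ## Scaling the transport -/

section Scale

variable {k : Type} [Field k] [NumberField k] (W : PlaneData k)

/-- The orbit invariant of the scaled transport `c • g` is `c²` times the invariant. -/
theorem orbitInv_smul (c : k) (g : Matrix (Fin 4) (Fin 4) k) (x : GA W) :
    orbitInv W (c • g) x = algebraMap k (Ad k) c ^ 2 * orbitInv W g x := by
  unfold orbitInv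
  rw [adMat_smul_eq, Matrix.mul_smul]
  have h : blockTL (algebraMap k (Ad k) c • (GA.mat W x * adMat k g)) =
      algebraMap k (Ad k) c • blockTL (GA.mat W x * adMat k g) := by
    ext i j
    simp only [blockTL_apply, Matrix.smul_apply]
  rw [h, Matrix.det_smul, Fintype.card_fin]

/-- Distinct invariants stay distinct after scaling the transport by `c ≠ 0` (a unit of `𝔸_k`). -/
theorem orbitInv_smul_ne {c : k} (hc : c ≠ 0) (g : Matrix (Fin 4) (Fin 4) k) {x y : GA W}
    (h : orbitInv W g x ≠ orbitInv W g y) : orbitInv W (c • g) x ≠ orbitInv W (c • g) y := by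
  rw [orbitInv_smul, orbitInv_smul]
  intro heq
  apply h
  have hu : IsUnit (algebraMap k (Ad k) c ^ 2) :=
    ((isUnit_iff_ne_zero.mpr hc).map (algebraMap k (Ad k))).pow 2
  exact hu.mul_right_injective heq

end Scale

/-! ## The denominator read-out with a scaled transport -/

section Seesaw

variable {k : Type} [Field k] [NumberField k] (q : QuadData k) (a b ε a' b' ε' : k)
  (g g' : Matrix (Fin 4) (Fin 4) k) (hgg' : g * g' = 1) (hg'g : g' * g = 1)
  (hgΩ : g * (PlaneData.ofLinesRow q a b ε).Ω = (PlaneData.ofLinesRow q a b ε).Ω * g)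

/-- **The denominator read-out at the rational point with the transport scaled to be finite-integral**
(`_smul_seesaw'` of OrbitInvariantDenominator with `c • g`, `c ≠ 0`, in place of an integral `g`): off the fibre of
`γ₀`, `log (max 1 (N / D² − B)) ≤ 2 · archDist γ + log (2 G²)`. -/
theorem log_max_one_le_two_mul_archDist_add_of_orbitInv_ne_smul_seesaw'' (ha : a ≠ 0) (hb : b ≠ 0) (hε : ε ≠ 0)
    (ha' : a' ≠ 0) (hb' : b' ≠ 0) (hε' : ε' ≠ 0) (lam : k)
    (hiso : g * (PlaneData.ofLinesRow q a' b' ε').B * gᵀ = lam • (PlaneData.ofLinesRow q a b ε).B)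
    {N : ℕ} (hN : N ≠ 0) {c : k} (hc : c ≠ 0) (hcg : IsIntegralFinMat (adMat k (c • g))) {G : ℝ} (hG1 : 1 ≤ G)
    (hG : ∀ (w : InfinitePlace k) (l j : Fin 4), ‖Common.adToC w (adMat k (c • g) l j)‖ ≤ G)
    {κ₁ κ₂ τ γ τ' γ₀ : GA ((PlaneData.ofLinesRow q a b ε).withTransportedTorus g g' hgg' hg'g hgΩ)}
    (hκ₁ : κ₁ ∈ levelK _ N) (hκ₂ : κ₂ ∈ levelK _ N)
    (hτ : τ ∈ torusT ((PlaneData.ofLinesRow q a b ε).withTransportedTorus g g' hgg' hg'g hgΩ))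
    (hτ' : τ' ∈ torusT' ((PlaneData.ofLinesRow q a b ε).withTransportedTorus g g' hgg' hg'g hgΩ))
    (hγ : γ ∈ rationalPoints _) (hγ₀ : γ₀ ∈ rationalPoints _) {D : ℕ} (hD0 : D ≠ 0)
    (hD : IsIntegralFinMat ((D : Ad k) • GA.mat _ γ₀))
    (hcos : GA.ofFinPart _ (τ * γ * τ') = κ₁ * GA.ofFinPart _ γ₀ * κ₂)
    (hne : orbitInv _ g γ ≠ orbitInv _ g γ₀)
    {B : ℝ} (hB : ∀ w : InfinitePlace k, ‖Common.adToC w (orbitInv _ (c • g) γ₀)‖ ≤ B) :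
    Real.log (max 1 ((N : ℝ) / (D : ℝ) ^ 2 - B)) ≤ 2 * L1Class.archDist _ γ + Real.log (2 * G ^ 2) := by
  obtain ⟨m, hm⟩ := exists_rational_mat_of_mem_rationalPoints _ hγ
  have hxy : orbitInv _ (c • g) (τ * γ * τ') = orbitInv _ (c • g) γ := by
    rw [orbitInv_smul, orbitInv_smul,
      orbitInv_orbit q a b ε a' b' ε' g g' hgg' hg'g hgΩ ha hb hε ha' hb' hε' lam hiso τ γ τ' hτ hτ']
  exact log_max_one_le_two_mul_archDist_add_of_orbitInv_ne_smul _ (c • g) hN hcg hG1 hG hκ₁ hκ₂ hγ₀ hD0 hD hcos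
    hxy (orbitInv_eq_algebraMap _ (c • g) hm) (orbitInv_smul_ne _ hc g hne) hB

end Seesaw

/-! ## The `hR` discharge -/

section Wrapper

variable {k : Type} [Field k] [NumberField k] (q : QuadData k) (a b ε a' b' ε' : k)
  (g g' : Matrix (Fin 4) (Fin 4) k) (hgg' : g * g' = 1) (hg'g : g' * g = 1)
  (hgΩ : g * (PlaneData.ofLinesRow q a b ε).Ω = (PlaneData.ofLinesRow q a b ε).Ω * g)
  (W : PlaneData k) (hW : W = (PlaneData.ofLinesRow q a b ε).withTransportedTorus g g' hgg' hg'g hgΩ)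
  [MeasurableSpace (GA W)] [BorelSpace (GA W)] (R : RTFData W) (μ : Measure (GA W))
  [μ.IsHaarMeasure] [R.μT.IsHaarMeasure] [R.μT'.IsHaarMeasure] (DG : Set (GA W))
  (fdG : IsFundamentalDomain (rationalPoints W) DG μ) (compG : IsCompact (closure DG))
  (compT : IsCompact (closure R.DT)) (compT' : IsCompact (closure R.DT'))

include hW in
/-- **THE `hR` DISCHARGE** (the (S-SPARSE) display of the (7b) glue): on the transported row plane, for a family
`ffin (lev N)`, `f₂ (lev N)` supported on the level-`lev N` double coset of `γ₀` (`hfin`, `hfin₂` = `TailFamily'`'s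
`suppFin`, `suppFin₂`) along `lev N = p ^ (N + n₁)` (`2 ≤ p`), and with the fibre bridge `hbridge`, there is a
sparsity scale `gth → ∞` with `gth N ≤ archDist γ` for every rational `γ` off the orbit of `γ₀` at which the
convolution does not vanish on `DT⁻¹ γ DT′`.  `gth N = (log (max 1 (p^(N+n₁) / D² − B)) − log (2 G²)) / 2`. -/
theorem exists_sparsityScale_hR (ha : a ≠ 0) (hb : b ≠ 0) (hε : ε ≠ 0) (ha' : a' ≠ 0) (hb' : b' ≠ 0) (hε' : ε' ≠ 0)
    (lam : k) (hiso : g * (PlaneData.ofLinesRow q a' b' ε').B * gᵀ = lam • (PlaneData.ofLinesRow q a b ε).B)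
    (γ₀ : (Setting.ofAdelicData W R μ DG fdG compG compT compT').Gk)
    (hbridge : ∀ γ : (Setting.ofAdelicData W R μ DG fdG compG compT compT').Gk,
      (Setting.ofAdelicData W R μ DG fdG compG compT compT').orbitOf γ ≠
        (Setting.ofAdelicData W R μ DG fdG compG compT compT').orbitOf γ₀ →
      orbitInv W g (γ : GA W) ≠ orbitInv W g (γ₀ : GA W))
    (finf : GA W → ℂ) (ffin f₂ : ℕ → GA W → ℂ) (p n₁ : ℕ) (hp : 2 ≤ p)
    (hfin : ∀ (N : ℕ) (x : GA W), ffin (p ^ (N + n₁)) x ≠ 0 →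
      ∃ κ₁ ∈ levelK W (p ^ (N + n₁)), ∃ κ₂ ∈ levelK W (p ^ (N + n₁)),
        GA.ofFinPart W x = κ₁ * GA.ofFinPart W (γ₀ : GA W) * κ₂)
    (hfin₂ : ∀ (N : ℕ) (x : GA W), f₂ (p ^ (N + n₁)) x ≠ 0 → GA.ofFinPart W x ∈ levelK W (p ^ (N + n₁))) :
    ∃ gth : ℕ → ℝ, Tendsto gth atTop atTop ∧
      ∀ (N : ℕ) (γ : (Setting.ofAdelicData W R μ DG fdG compG compT compT').Gk),
        (Setting.ofAdelicData W R μ DG fdG compG compT compT').orbitOf γ ∉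
          ({(Setting.ofAdelicData W R μ DG fdG compG compT compT').orbitOf γ₀} :
            Finset (Setting.ofAdelicData W R μ DG fdG compG compT compT').Orbit) →
        (∃ t ∈ R.DT, ∃ t' ∈ R.DT',
          (Setting.ofAdelicData W R μ DG fdG compG compT compT').conv
            (L1Class.prodFn W finf (ffin (p ^ (N + n₁)))) (f₂ (p ^ (N + n₁)))
            ((t : GA W)⁻¹ * γ * (t' : GA W)) ≠ 0) →
        gth N ≤ L1Class.archDist W (γ : GA W) := by
  obtain ⟨c, hc0, hcg⟩ := exists_integer_smul_isIntegralFinMat g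
  obtain ⟨G, hG1, hG⟩ := exists_bound_entries_adMat ((c : k) • g)
  obtain ⟨D, hD0, hD⟩ := exists_nat_smul_isIntegralFinMat_of_mem_rationalPoints W γ₀.2
  obtain ⟨B, hB⟩ := exists_bound_orbitInv W ((c : k) • g) (γ₀ : GA W)
  refine ⟨fun N => (Real.log (max 1 ((p : ℝ) ^ (N + n₁) / (D : ℝ) ^ 2 - B)) - Real.log (2 * G ^ 2)) / 2,
    ?_, ?_⟩
  · have hD' : (0 : ℝ) < (D : ℝ) ^ 2 := by positivity
    exact (tendsto_sparsityScale_pow_div hp hD' B (Real.log (2 * G ^ 2))).comp (tendsto_add_atTop_nat n₁)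
  · intro N γ hoff hsupp
    obtain ⟨t, _, t', _, hne0⟩ := hsupp
    have hmem := mem_levelSuppSet_conv W (Setting.ofAdelicData W R μ DG fdG compG compT compT') (γ₀ : GA W)
      finf ffin f₂ (p ^ (N + n₁)) (hfin N) (hfin₂ N) (γ : GA W) t t' hne0
    have hmem' : GA.ofFinPart W ((t : GA W)⁻¹ * γ * (t' : GA W)) ∈
        levelDoubleCoset W (p ^ (N + n₁)) (GA.ofFinPart W (γ₀ : GA W)) := hmem
    obtain ⟨κ₁, hκ₁, κ₂, hκ₂, hcos⟩ := exists_eq_mul_of_mem_mul_singleton_mul W _ _ _ hmem'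
    have hne : orbitInv W g (γ : GA W) ≠ orbitInv W g (γ₀ : GA W) :=
      hbridge γ fun h => hoff (Finset.mem_singleton.mpr h)
    have hN : p ^ (N + n₁) ≠ 0 := pow_ne_zero _ (by omega)
    have hc : (c : k) ≠ 0 := by exact_mod_cast hc0
    have hγ : (γ : GA W) ∈ rationalPoints W := γ.2
    have hγ₀ : (γ₀ : GA W) ∈ rationalPoints W := γ₀.2
    have hτ : (t : GA W)⁻¹ ∈ torusT W := (torusT W).inv_mem t.2
    have hτ' : (t' : GA W) ∈ torusT' W := t'.2
    subst hW
    have key := log_max_one_le_two_mul_archDist_add_of_orbitInv_ne_smul_seesaw'' q a b ε a' b' ε' g g' hgg' hg'g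
      hgΩ ha hb hε ha' hb' hε' lam hiso hN hc hcg hG1 hG hκ₁ hκ₂ hτ hτ' hγ hγ₀ hD0 hD hcos hne hB
    rw [Nat.cast_pow] at key
    exact sparsityScale_le_of_le_two_mul_add key

include hW in
/-- **THE `hR` DISCHARGE, TRANSPORTERS SEPARATED** (crit-2 Entry 297, repair (A)): the fibre bridge is asked only at
NON-transporters (`¬ (γ⁻¹ T γ = T′)`, where DichotomyLin + LinRegularBridge supply it), and the transporters are
excluded from the level support by the glue's own `hsep` (the (S-SEP) display, verbatim shape): a non-zero value of
the convolution at `t⁻¹ γ t′` puts `ofFinPart (t⁻¹ γ t′)` into `K(lev N) γ₀,f K(lev N)`, which `hsep` forbids for a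
transporter `γ` — so the transporter case of `hR` is vacuous. -/
theorem exists_sparsityScale_hR' (ha : a ≠ 0) (hb : b ≠ 0) (hε : ε ≠ 0) (ha' : a' ≠ 0) (hb' : b' ≠ 0) (hε' : ε' ≠ 0)
    (lam : k) (hiso : g * (PlaneData.ofLinesRow q a' b' ε').B * gᵀ = lam • (PlaneData.ofLinesRow q a b ε).B)
    (γ₀ : (Setting.ofAdelicData W R μ DG fdG compG compT compT').Gk)
    (hbridge : ∀ γ : (Setting.ofAdelicData W R μ DG fdG compG compT compT').Gk,
      ¬ ((torusT W).map (MulAut.conj ((γ : GA W))⁻¹).toMonoidHom = torusT' W) →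
      (Setting.ofAdelicData W R μ DG fdG compG compT compT').orbitOf γ ≠
        (Setting.ofAdelicData W R μ DG fdG compG compT compT').orbitOf γ₀ →
      orbitInv W g (γ : GA W) ≠ orbitInv W g (γ₀ : GA W))
    (finf : GA W → ℂ) (ffin f₂ : ℕ → GA W → ℂ) (p n₁ : ℕ) (hp : 2 ≤ p)
    (hsep : ∀ n ≥ n₁, ∀ γ : rationalPoints W,
      (torusT W).map (MulAut.conj ((γ : GA W))⁻¹).toMonoidHom = torusT' W →
      ∀ t ∈ torusT W, ∀ t' ∈ torusT' W,
        GA.ofFinPart W (t⁻¹ * (γ : GA W) * t') ∉ levelDoubleCoset W (p ^ n) (GA.ofFinPart W (γ₀ : GA W)))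
    (hfin : ∀ (N : ℕ) (x : GA W), ffin (p ^ (N + n₁)) x ≠ 0 →
      ∃ κ₁ ∈ levelK W (p ^ (N + n₁)), ∃ κ₂ ∈ levelK W (p ^ (N + n₁)),
        GA.ofFinPart W x = κ₁ * GA.ofFinPart W (γ₀ : GA W) * κ₂)
    (hfin₂ : ∀ (N : ℕ) (x : GA W), f₂ (p ^ (N + n₁)) x ≠ 0 → GA.ofFinPart W x ∈ levelK W (p ^ (N + n₁))) :
    ∃ gth : ℕ → ℝ, Tendsto gth atTop atTop ∧
      ∀ (N : ℕ) (γ : (Setting.ofAdelicData W R μ DG fdG compG compT compT').Gk),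
        (Setting.ofAdelicData W R μ DG fdG compG compT compT').orbitOf γ ∉
          ({(Setting.ofAdelicData W R μ DG fdG compG compT compT').orbitOf γ₀} :
            Finset (Setting.ofAdelicData W R μ DG fdG compG compT compT').Orbit) →
        (∃ t ∈ R.DT, ∃ t' ∈ R.DT',
          (Setting.ofAdelicData W R μ DG fdG compG compT compT').conv
            (L1Class.prodFn W finf (ffin (p ^ (N + n₁)))) (f₂ (p ^ (N + n₁)))
            ((t : GA W)⁻¹ * γ * (t' : GA W)) ≠ 0) →
        gth N ≤ L1Class.archDist W (γ : GA W) := by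
  obtain ⟨c, hc0, hcg⟩ := exists_integer_smul_isIntegralFinMat g
  obtain ⟨G, hG1, hG⟩ := exists_bound_entries_adMat ((c : k) • g)
  obtain ⟨D, hD0, hD⟩ := exists_nat_smul_isIntegralFinMat_of_mem_rationalPoints W γ₀.2
  obtain ⟨B, hB⟩ := exists_bound_orbitInv W ((c : k) • g) (γ₀ : GA W)
  refine ⟨fun N => (Real.log (max 1 ((p : ℝ) ^ (N + n₁) / (D : ℝ) ^ 2 - B)) - Real.log (2 * G ^ 2)) / 2,
    ?_, ?_⟩
  · have hD' : (0 : ℝ) < (D : ℝ) ^ 2 := by positivity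
    exact (tendsto_sparsityScale_pow_div hp hD' B (Real.log (2 * G ^ 2))).comp (tendsto_add_atTop_nat n₁)
  · intro N γ hoff hsupp
    obtain ⟨t, _, t', _, hne0⟩ := hsupp
    have hmem := mem_levelSuppSet_conv W (Setting.ofAdelicData W R μ DG fdG compG compT compT') (γ₀ : GA W)
      finf ffin f₂ (p ^ (N + n₁)) (hfin N) (hfin₂ N) (γ : GA W) t t' hne0
    have hmem' : GA.ofFinPart W ((t : GA W)⁻¹ * γ * (t' : GA W)) ∈
        levelDoubleCoset W (p ^ (N + n₁)) (GA.ofFinPart W (γ₀ : GA W)) := hmem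
    have hτ : (t : GA W)⁻¹ ∈ torusT W := (torusT W).inv_mem t.2
    have hτ' : (t' : GA W) ∈ torusT' W := t'.2
    -- the transporters are excluded from the level support by `hsep`
    have hntr : ¬ ((torusT W).map (MulAut.conj ((γ : GA W))⁻¹).toMonoidHom = torusT' W) := by
      intro htr
      have hsep' := hsep (N + n₁) (Nat.le_add_left n₁ N) γ htr (t : GA W) t.2 (t' : GA W) hτ'
      exact hsep' hmem'
    obtain ⟨κ₁, hκ₁, κ₂, hκ₂, hcos⟩ := exists_eq_mul_of_mem_mul_singleton_mul W _ _ _ hmem'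
    have hne : orbitInv W g (γ : GA W) ≠ orbitInv W g (γ₀ : GA W) :=
      hbridge γ hntr fun h => hoff (Finset.mem_singleton.mpr h)
    have hN : p ^ (N + n₁) ≠ 0 := pow_ne_zero _ (by omega)
    have hc : (c : k) ≠ 0 := by exact_mod_cast hc0
    have hγ : (γ : GA W) ∈ rationalPoints W := γ.2
    have hγ₀ : (γ₀ : GA W) ∈ rationalPoints W := γ₀.2
    subst hW
    have key := log_max_one_le_two_mul_archDist_add_of_orbitInv_ne_smul_seesaw'' q a b ε a' b' ε' g g' hgg' hg'g
      hgΩ ha hb hε ha' hb' hε' lam hiso hN hc hcg hG1 hG hκ₁ hκ₂ hτ hτ' hγ hγ₀ hD0 hD hcos hne hB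
    rw [Nat.cast_pow] at key
    exact sparsityScale_le_of_le_two_mul_add key

end Wrapper

end

end Summit.Ventures.HodgeRepro.Tier4.Line4
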